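import Literature.Analysis.FluidPDE.GradientRegularityCriteria
import Literature.Analysis.FluidPDE.BeiraoDaVeigaEnstrophyGronwall
import Literature.Analysis.FluidPDE.NSSerrinRegularityProofs
import Literature.Analysis.FluidPDE.CheskidovShvydkoyRegularProofs
import Literature.Analysis.FluidPDE.LerayH1ContinuationProofs
import HarnessLib

/-!
# Discharge of Beirão da Veiga's gradient criterion on `ℝ³` (`∇u ∈ L^q(0,T; L^r)`, `2/q + 3/r = 2`)

search for candidate a priori estimates; no regularity claim (cell `pub-nsfunc`, literature seat:
this file PROVES a published criterion the cell vendored as a named fact; nothing new).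

Analysis/FluidPDE proof file (theorems only: no definition, no named fact, no `sorry`), sibling of
`GradientRegularityCriteria.lean`, which vendors four Serrin-type criteria of Lemarié-Rieusset 2016,
§11.5, as named facts in continuation form. **Discharged here**:

  `BeiraoDaVeiga1995_gradientCriterion_holds : BeiraoDaVeiga1995_gradientCriterion`

(H. Beirão da Veiga, Chinese Ann. Math. Ser. B 16 (1995) 407–412; Berselli–Galdi, Proc. Amer. Math.
Soc. 130 (2002), (1.3) p. 3586: "if `∇u ∈ L^r(0,T;L^s(ℝⁿ))` with `2/r + n/s = 2`, for `s > n/2`,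
then weak solutions are of class `C^∞(ℝⁿ × (0,T])`; see Beirão da Veiga [2] and Galdi [10]; see
also Berselli [8] for a simple proof when `n = 3`"; Lemarié-Rieusset 2016, §11.5, list p. 329):
a classical solution of the unforced system on `ℝ³ × [0, T)` which is Leray–Hopf from its datum and
has `∇u ∈ L^q(0,T; L^r(ℝ³))`, `2/q + 3/r = 2`, `1 < q < ∞`, extends as a classical solution past `T`.

## The argument (Berselli's "simple proof when `n = 3`": the enstrophy estimate; assembled on the
## tree's Leray–Hopf structure theory exactly as ns.S07 `ladyzhenskaya_prodi_serrin_holds`)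

1. *Exponents.* `1 < q < ∞` and `2/q + 3/r = 2` give `3/2 < r < ∞` and `q = 2r/(2r-3) = 1/θ`,
   `θ = 1 - 3/(2r)` (`bdv_exponents`); membership in the mixed class gives a finite time integral
   `Ā = ∫₀ᵀ ‖∇u(t)‖_{L^r}^q dt` and `∇u(t) ∈ L^r` for a.e. `t` (`lintegral_ofReal_rpow_gradient_lt_top`).
2. *No blow-up of the enstrophy before `T`* (`exists_eWeakGradL2Sq_le_of_gradient`,
   `limsup_eH1NormSq_lt_top_of_gradient`): on an `H¹`-regular interval `(α, β) ⊆ (0, T)` of the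
   Leray–Hopf solution, `‖∇u(τ)‖² ≤ exp(C ν^{1-q} ∫_{t₀}^{τ} ‖∇u‖^q_{L^r}) ‖∇u(t₀)‖²` is continued
   along `[t₀, t]` by real induction (`forall_Icc_of_local_propagation`); locally it is Beirão da
   Veiga's enstrophy inequality `bdv_enstrophy_bound` (`BeiraoDaVeigaEnstrophyGronwall.lean`)
   applied to a classical patch of Tao's class issued from a good time (`exists_tao_patch`,
   `taoSlab_translate`) — whose slices coincide EVERYWHERE with the (continuous) slices of the
   classical `u`, so that the gradient data `‖∇u(t)‖_{L^r}` transfer to the patch; the exponentials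
   chain (`exp_lintegral_chain`). With the energy bound `IsLerayHopfOn.eEnergy_le_datum`,
   `limsup_{β⁻} ‖u‖²_{H¹} < ∞`.
3. *Continuation.* Leray's continuation theorem (`leray_continuation_H1_holds`; Cheskidov–Shvydkoy
   2010, Thm. 2.4) gives `H¹`-regularity on `(0, T]`; then, verbatim as the tree's continuation of
   bounded solutions (`hasSmoothExtensionPast_of_bounded_of_local_H1_theory`, Robinson–Rodrigo–
   Sadowski 2016, proof of Thm. 12.3, p. 170): restart at a good time `s` near `T` with Leray's
   local strong solution (`leray_local_strong_H1_holds`, lifespan beyond `T` by the `H¹` bound on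
   `[T/2, T]`), represent it classically (`ladyzhenskaya_prodi_serrin_holds`, class `L^∞_t L⁶_x`),
   identify it with `u` on `(s, T)` by weak–strong uniqueness (`serrin_weak_strong_uniqueness_holds`)
   and continuity, and glue (`IsClassicalNSSolutionOn.glue`).

The rapid-decay hypothesis `HasRapidSpatialDecay (u 0)` of the named fact is not used (the
statement keeps it; it is proved as stated). Net effect on the facts census: `−1`
(`BeiraoDaVeiga1995_gradientCriterion` discharged; nothing new vendored).

## Mathlib / tree search

`lean search 'BeiraoDaVeiga1995_gradientCriterion_holds'`: absent before this file. All inputs are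
accepted tree theorems, cited in place; Mathlib has no Navier–Stokes theory. Generic lemmas proved
here: translation of an a.e.-in-time property (`measurePreserving_add_right`, `ae_of_ae_map`).

## References

* H. Beirão da Veiga, *A new regularity class for the Navier–Stokes equations in ℝⁿ*, Chinese
  Ann. Math. Ser. B 16 (1995) 407–412. [BeiraoDaVeiga1995]
* L. C. Berselli, G. P. Galdi, Proc. Amer. Math. Soc. 130 (2002) 3585–3595, (1.3) p. 3586
  (held: paper:doi-10-1090-s0002-9939-02-06697-2, PDF p. 2). [BerselliGaldi2002]
* P. G. Lemarié-Rieusset, *The Navier–Stokes Problem in the 21st Century*, CRC Press (2016),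
  §11.5, list p. 329 (PDF p. 353); Thm. 11.2. [LemarieRieusset2016]
* J. C. Robinson, J. L. Rodrigo, W. Sadowski, *The Three-Dimensional Navier–Stokes Equations*,
  CUP (2016), Lemma 8.16, Thm. 8.17, Thm. 6.15, Thm. 6.10, proof of Thm. 12.3 (p. 170).
  [RobinsonRodrigoSadowski2016]
* A. Cheskidov, R. Shvydkoy, Arch. Ration. Mech. Anal. 195 (2010), Thm. 2.4. [CheskidovShvydkoy2010]
* T. Tao, Anal. PDE 6 (2013), Thm. 5.4, Prop. 5.6. [Tao2011]
-/

noncomputable section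

open MeasureTheory Set Function Filter Topology InnerProductSpace
open scoped ENNReal NNReal ContDiff RealInnerProductSpace

namespace Literature.Analysis.FluidPDE

-- Physical space is written out as `EuclideanSpace ℝ (Fin 3)` (no local notation).

/-! ### Exponent bookkeeping: `2/q + 3/r = 2`, `1 < q < ∞` -/

section Exponents

/-- **Exponent bookkeeping for Beirão da Veiga's class.** In `ℝ≥0∞`: if `1 < q < ∞` and
`2/q + 3/r = 2` then `3/2 < r < ∞` and `q.toReal = 1/(1 - 3/(2 r.toReal))` (the Young conjugacy
of the slice estimate). [cite: BerselliGaldi2002, (1.3) p. 3586] -/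
theorem bdv_exponents {q r : ℝ≥0∞} (h1q : 1 < q) (hqtop : q < ⊤) (hqr : 2 / q + 3 / r = 2) :
    r ≠ ⊤ ∧ 3 / 2 < r ∧ q.toReal = 1 / (1 - 3 / (2 * r.toReal)) := by
  have hq0 : q ≠ 0 := (lt_trans zero_lt_one h1q).ne'
  have hqtop' : q ≠ ⊤ := hqtop.ne
  have hr0 : r ≠ 0 := by
    rintro rfl
    rw [ENNReal.div_zero (by norm_num : (3 : ℝ≥0∞) ≠ 0), add_top] at hqr
    exact absurd hqr ENNReal.top_ne_ofNat
  have h2q : 2 / q ≠ ⊤ := ENNReal.div_ne_top (by norm_num) hq0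
  have h3r : 3 / r ≠ ⊤ := ENNReal.div_ne_top (by norm_num) hr0
  -- the real equation
  have hreal : 2 / q.toReal + 3 / r.toReal = 2 := by
    have h := congrArg ENNReal.toReal hqr
    rw [ENNReal.toReal_add h2q h3r, ENNReal.toReal_div, ENNReal.toReal_div, ENNReal.toReal_ofNat,
      ENNReal.toReal_ofNat] at h
    simpa using h
  have hq1 : 1 < q.toReal := by
    rw [← ENNReal.toReal_one]; exact (ENNReal.toReal_lt_toReal ENNReal.one_ne_top hqtop').2 h1q
  have hqpos : 0 < q.toReal := by linarith
  -- `r ≠ ⊤`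
  have hrtop : r ≠ ⊤ := by
    intro hr
    rw [hr, ENNReal.toReal_top, div_zero, add_zero] at hreal
    have : q.toReal = 1 := by
      field_simp at hreal
      linarith
    linarith
  have hρ0 : 0 < r.toReal := ENNReal.toReal_pos hr0 hrtop
  -- `3/2 < r`
  have h2q' : 0 < 2 / q.toReal := by positivity
  have hρ32 : 3 / 2 < r.toReal := by
    have h3 : 3 / r.toReal < 2 := by linarith
    rw [div_lt_iff₀ hρ0] at h3
    linarith
  have hr32 : (3 / 2 : ℝ≥0∞) < r := by
    have h : ((3 / 2 : ℝ≥0∞)).toReal < r.toReal := by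
      rw [ENNReal.toReal_div, ENNReal.toReal_ofNat, ENNReal.toReal_ofNat]; exact hρ32
    exact (ENNReal.toReal_lt_toReal (ENNReal.div_ne_top (by norm_num) (by norm_num)) hrtop).1 h
  refine ⟨hrtop, hr32, ?_⟩
  -- `q.toReal = 1/θ`
  have hθ : 1 - 3 / (2 * r.toReal) = 1 / q.toReal := by
    have e1 : 3 / (2 * r.toReal) = (3 / r.toReal) / 2 := by
      rw [div_div, mul_comm]
    rw [e1]
    have : 3 / r.toReal = 2 - 2 / q.toReal := by linarith
    rw [this]
    field_simp
    ring
  rw [hθ, one_div_one_div]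

/-- **The Beirão da Veiga time integral of a member of `L^q_t L^r_x` is finite.** For
`1 < q < ∞`, `2/q + 3/r = 2` and `∇u ∈ L^q((0,T); L^r)` (`MemLqLp q r (fun t x => Du(t)(x)) (Ioo 0 T)`),
the lower integral `∫₀ᵀ ‖∇u(t)‖_{L^r}^{q'} dt` with `q' = 1/(1 - 3/(2r)) = q.toReal` is finite, and
`∇u(t) ∈ L^r` for a.e. `t ∈ (0, T)`. [cite: BerselliGaldi2002, (1.3) p. 3586] -/
theorem lintegral_ofReal_rpow_gradient_lt_top {X F : Type*} [MeasureSpace X] [NormedAddCommGroup F]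
    {q r : ℝ≥0∞} {G : ℝ → X → F} {T : ℝ} (h1q : 1 < q) (hqtop : q < ⊤)
    (hqr : 2 / q + 3 / r = 2) (hS : MemLqLp q r G (Ioo 0 T)) :
    (∫⁻ t in Ioo 0 T, ENNReal.ofReal
      ((eLpNorm (G t) r volume).toReal ^ (1 / (1 - 3 / (2 * r.toReal)))) < ⊤) ∧
    ∀ᵐ t ∂volume, t ∈ Ioo 0 T → eLpNorm (G t) r volume < ⊤ := by
  obtain ⟨-, -, hqθ⟩ := bdv_exponents h1q hqtop hqr
  have hq0 : q ≠ 0 := (lt_trans zero_lt_one h1q).ne'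
  set N : ℝ → ℝ := fun t => (eLpNorm (G t) r volume).toReal with hN
  have hN0 : ∀ t, 0 ≤ N t := fun t => ENNReal.toReal_nonneg
  refine ⟨?_, ?_⟩
  · have hlt : ∫⁻ t, ‖N t‖ₑ ^ q.toReal ∂(volume.restrict (Ioo 0 T)) < ⊤ :=
      lintegral_rpow_enorm_lt_top_of_eLpNorm_lt_top hq0 hqtop.ne hS.2
    rw [← hqθ]
    refine lt_of_le_of_lt (le_of_eq (lintegral_congr fun t => ?_)) hlt
    rw [Real.enorm_eq_ofReal (hN0 t), ENNReal.ofReal_rpow_of_nonneg (hN0 t) ENNReal.toReal_nonneg]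
  · have h := hS.1
    rw [ae_restrict_iff' measurableSet_Ioo] at h
    filter_upwards [h] with t ht htI
    exact (ht htI).eLpNorm_lt_top

end Exponents

/-! ### Step A: the Beirão da Veiga bound at the right end of an interval of regularity -/

section StepA

variable {ν T : ℝ} {u₀ : EuclideanSpace ℝ (Fin 3) → EuclideanSpace ℝ (Fin 3)}
  {u : ℝ → EuclideanSpace ℝ (Fin 3) → EuclideanSpace ℝ (Fin 3)}
  {p : ℝ → EuclideanSpace ℝ (Fin 3) → ℝ}

/-- **Transfer of the gradient time integral to a representative**: if
`D(w(t)) = D(u(t + τ₁))` for `t ∈ (0, L')`, then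
`∫_{(0,L')} ‖∇w(t)‖_{L^r}^{q'} dt = ∫_{(τ₁, τ₁+L')} ‖∇u(σ)‖_{L^r}^{q'} dσ` (translation invariance of
Lebesgue measure, `setLIntegral_Ioo_comp_add_right`). [folklore] -/
private theorem lintegral_gradient_rep {r : ℝ≥0∞} {q' : ℝ}
    {w : ℝ → EuclideanSpace ℝ (Fin 3) → EuclideanSpace ℝ (Fin 3)} {τ₁ L' : ℝ}
    (hrep : ∀ t ∈ Ioo 0 L', fderiv ℝ (w t) = fderiv ℝ (u (t + τ₁))) :
    ∫⁻ t in Ioo 0 L', ENNReal.ofReal ((eLpNorm (fderiv ℝ (w t)) r volume).toReal ^ q') =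
      ∫⁻ σ in Ioo τ₁ (τ₁ + L'), ENNReal.ofReal ((eLpNorm (fderiv ℝ (u σ)) r volume).toReal ^ q') := by
  have h1 : ∫⁻ t in Ioo 0 L', ENNReal.ofReal ((eLpNorm (fderiv ℝ (w t)) r volume).toReal ^ q') =
      ∫⁻ t in Ioo 0 L', ENNReal.ofReal ((eLpNorm (fderiv ℝ (u (t + τ₁))) r volume).toReal ^ q') := by
    refine setLIntegral_congr_fun measurableSet_Ioo fun t ht => ?_
    rw [hrep t ht]
  rw [h1, setLIntegral_Ioo_comp_add_right
    (fun σ => ENNReal.ofReal ((eLpNorm (fderiv ℝ (u σ)) r volume).toReal ^ q')) 0 L' τ₁, zero_add,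
    add_comm]

/-- **Transfer of an a.e.-in-time property along a time translation** (Lebesgue measure on `ℝ`
is translation invariant, `measurePreserving_add_right`). [folklore] -/
private theorem ae_comp_add_right {P : ℝ → Prop} (h : ∀ᵐ σ ∂volume, P σ) (τ₁ : ℝ) :
    ∀ᵐ t ∂volume, P (t + τ₁) := by
  have hmp : MeasurePreserving (fun t : ℝ => t + τ₁) volume volume :=
    measurePreserving_add_right volume τ₁
  have h1 : ∀ᵐ y ∂(Measure.map (fun t : ℝ => t + τ₁) volume), P y := by
    rw [hmp.map_eq]; exact h
  exact ae_of_ae_map hmp.measurable.aemeasurable h1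

/-- **Uniform enstrophy bound towards the right end of an interval of regularity, in the Beirão
da Veiga class** (the twin of `exists_eWeakGradL2Sq_le_of_serrin`; Berselli–Galdi 2002, (1.3):
"weak solutions are of class `C^∞(ℝⁿ × (0, T])`", i.e. no blow-up of `‖∇u‖₂` before `T`). Let
`(u, p)` be a classical solution of the unforced system on `ℝ³ × [0, T)` which is Leray–Hopf on
`[0, T)`, with `∇u(σ) ∈ L^r` for a.e. `σ ∈ (0, T)` and finite time integral
`Ā = ∫₀ᵀ ‖∇u‖_{L^r}^{q'} < ∞` (`3/2 < r < ∞`, `q' = 1/(1 - 3/(2r))`), `H¹`-regular on an open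
interval `(α, β) ⊆ (0, T)`, and `t₀ ∈ (α, β)`. Given Tao's local `H¹` theory
(`TaoH1AlmostRegularWith c`, `c > 0`), for every `t ∈ [t₀, β)`:
`‖∇u(t)‖² ≤ exp(C ν^{1-q'} Ā) ‖∇u(t₀)‖² < ∞`, `C` the constant of `bdv_enstrophy_bound`. Proof: the
bound is continued along `[t₀, t]` by `forall_Icc_of_local_propagation`; near any `σ` a classical
patch from a good time just below `σ` (`exists_tao_patch`) carries `τ₁ ≤ τ₂`; on it the slices of
the patch EQUAL those of `u` (both continuous, a.e. equal), so the gradient data transfer, and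
Beirão da Veiga's enstrophy inequality on the translated slab (`bdv_enstrophy_bound`) bounds
`‖∇u(τ₂)‖²` by `‖∇u(τ₁)‖²`; the exponentials chain (`exp_lintegral_chain`).
[cite: BerselliGaldi2002, (1.3) p. 3586] [cite: RobinsonRodrigoSadowski2016, Lemma 8.16 (proof)] -/
theorem exists_eWeakGradL2Sq_le_of_gradient {c : ℝ} (hL2 : TaoH1AlmostRegularWith c) (hc : 0 < c)
    (hν : 0 < ν) (hLH : IsLerayHopfOn T ν 0 u₀ u) (hcl : IsClassicalNSSolutionOn (Ico 0 T) ν 0 u p)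
    {r : ℝ≥0∞} (hr : 3 / 2 < r) (hrtop : r ≠ ⊤)
    (hLr : ∀ᵐ σ ∂volume, σ ∈ Ioo 0 T → eLpNorm (fderiv ℝ (u σ)) r volume < ⊤)
    (hA : ∫⁻ t in Ioo 0 T, ENNReal.ofReal
      ((eLpNorm (fderiv ℝ (u t)) r volume).toReal ^ (1 / (1 - 3 / (2 * r.toReal)))) ≠ ⊤)
    {α β : ℝ} (hα : 0 ≤ α) (hβ : β ≤ T) (hreg : IsH1RegularOn (Ioo α β) u)
    {t₀ : ℝ} (ht₀ : t₀ ∈ Ioo α β) :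
    ∃ K : ℝ≥0∞, K < ⊤ ∧ ∀ t ∈ Ico t₀ β, eWeakGradL2Sq (u t) ≤ K := by
  -- notation
  set q' : ℝ := 1 / (1 - 3 / (2 * r.toReal)) with hq'
  set a : ℝ → ℝ≥0∞ := fun σ => ENNReal.ofReal ((eLpNorm (fderiv ℝ (u σ)) r volume).toReal ^ q')
    with ha
  obtain ⟨C, hC0, hD2⟩ := bdv_enstrophy_bound hr hrtop
  set Cν : ℝ := C * ν ^ (1 - q') with hCν
  have hCν0 : 0 ≤ Cν := mul_nonneg hC0 (Real.rpow_nonneg hν.le _)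
  set y₀ : ℝ≥0∞ := eWeakGradL2Sq (u t₀) with hy₀def
  have hy₀ : y₀ < ⊤ := lt_of_le_of_lt le_add_self (hreg.eH1NormSq_lt_top ht₀)
  refine ⟨ENNReal.ofReal (Real.exp (Cν * (∫⁻ σ in Ioo 0 T, a σ).toReal)) * y₀,
    ENNReal.mul_lt_top ENNReal.ofReal_lt_top hy₀, fun t ht => ?_⟩
  have ht₀0 : 0 < t₀ := hα.trans_lt ht₀.1
  have htT : t < T := ht.2.trans_le hβ
  -- good restarting times
  have hgood : ∀ᵐ s ∂(volume.restrict (Ioo 0 T)),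
      IsLerayHopfOn (T - s) ν 0 (u s) (fun t => u (t + s)) := hLH.ae_isLerayHopfOn_restart hν.le
  -- a uniform `H¹` bound on the compact `[(α + t₀)/2, t]`
  have hKsub : Icc ((α + t₀) / 2) t ⊆ Ioo α β := fun s hs =>
    ⟨lt_of_lt_of_le (by linarith [ht₀.1]) hs.1, hs.2.trans_lt ht.2⟩
  obtain ⟨M, hM, hbound⟩ := hreg.exists_forall_le isCompact_Icc hKsub
  set Am : ℝ := M.toReal with hAm
  have hAm0 : 0 ≤ Am := ENNReal.toReal_nonneg
  set τM : ℝ := c * ν ^ 3 / (Am ^ 2 + 1) with hτM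
  have hτM0 : 0 < τM := by positivity
  have hτMc : Am ^ 2 * τM ≤ c * ν ^ 3 := by
    rw [hτM, mul_div_assoc']
    rw [div_le_iff₀ (by positivity)]
    nlinarith [mul_pos hc (pow_pos hν 3)]
  -- the propagated property
  set A : ℝ → ℝ := fun τ => (∫⁻ σ in Ioo t₀ τ, a σ).toReal with hAdef
  set P : ℝ → Prop := fun τ => eWeakGradL2Sq (u τ) ≤ ENNReal.ofReal (Real.exp (Cν * A τ)) * y₀
    with hPdef
  have hPt : P t := by
    refine forall_Icc_of_local_propagation (a := t₀) (b := t) (P := P) ?_ ?_ t ⟨ht.1, le_rfl⟩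
    · -- `P t₀`
      simp only [hPdef, hAdef, Ioo_self, Measure.restrict_empty, lintegral_zero_measure,
        ENNReal.toReal_zero, mul_zero, Real.exp_zero, ENNReal.ofReal_one, one_mul, hy₀def, le_refl]
    · -- local propagation around `σ ∈ [t₀, t]`
      intro σ hσ
      have hσT : σ ≤ T := (hσ.2.trans ht.2.le).trans hβ
      -- a good time `s` just below `σ`
      have hlo : 0 ≤ max ((α + t₀) / 2) (σ - τM / 2) := le_max_of_le_left (by linarith)
      have hlt : max ((α + t₀) / 2) (σ - τM / 2) < σ :=
        max_lt (by linarith [hσ.1, ht₀.1]) (by linarith)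
      obtain ⟨s, hs, hLHs⟩ := exists_mem_Ioo_of_ae_restrict_Ioo hlo hlt hσT hgood
      have hs1 : (α + t₀) / 2 < s := (le_max_left _ _).trans_lt hs.1
      have hs2 : σ - τM / 2 < s := (le_max_right _ _).trans_lt hs.1
      have hs0 : 0 < s := lt_of_le_of_lt (by linarith) hs1
      have hsT : s < T := hs.2.trans_le hσT
      have hsK : s ∈ Icc ((α + t₀) / 2) t := ⟨hs1.le, hs.2.le.trans hσ.2⟩
      have hAs : eH1NormSq (u s) ≤ ENNReal.ofReal Am := by
        rw [hAm, ENNReal.ofReal_toReal hM.ne]; exact hbound s hsK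
      set τ' : ℝ := min τM (T - s) with hτ'def
      refine ⟨min (σ - s) (τM / 2), lt_min (sub_pos.2 hs.2) (by positivity), ?_⟩
      intro τ₁ hτ₁ τ₂ hτ₂ hτ₁σ hτ₁₂ hτ₂σ hP1
      rcases eq_or_lt_of_le hτ₁₂ with heq | hlt12
      · rw [← heq]; exact hP1
      -- the patch from `s` covers `[τ₁, τ₂]`
      have hδ1 : min (σ - s) (τM / 2) ≤ σ - s := min_le_left _ _
      have hδ2 : min (σ - s) (τM / 2) ≤ τM / 2 := min_le_right _ _
      have hsτ₁ : s < τ₁ := by linarith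
      have hτ₂T : τ₂ < T := lt_of_le_of_lt hτ₂.2 htT
      have hτ₂τ' : τ₂ - s < τ' := by
        refine lt_min (by linarith) ?_
        linarith [hτ₂.2, ht.2, hβ]
      set ε : ℝ := τ₁ - s with hεdef
      have hε0 : 0 < ε := sub_pos.2 hsτ₁
      have hετ' : ε < τ' := lt_trans (by rw [hεdef]; linarith) hτ₂τ'
      obtain ⟨w, π, hw, hbw, hbwt, hbπ, hrep⟩ := exists_tao_patch hL2 hν hLH ⟨hs0, hsT⟩ hLHs hAm0
        hAs hτM0 hτMc (ε := ε) ⟨hε0, hετ'⟩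
      -- translate to the slab `[0, τ' - ε]`, i.e. `u`-times `[τ₁, s + τ']`
      obtain ⟨hw', hbw', hbwt', hbπ'⟩ := taoSlab_translate hw hbw hbwt hbπ (e := ε) ⟨le_rfl, hετ'⟩
      have hL : 0 < τ' - ε := sub_pos.2 hετ'
      have hrep' : ∀ t' ∈ Icc 0 (τ' - ε), u (t' + τ₁) =ᵐ[volume] w (t' + ε) := by
        intro t' ht'
        have h := hrep (t' + ε) ⟨by linarith [ht'.1], by linarith [ht'.2]⟩
        have e1 : t' + ε + s = t' + τ₁ := by rw [hεdef]; ring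
        rwa [e1] at h
      have hs12 : τ₂ - τ₁ ∈ Ioc 0 (τ' - ε) := ⟨sub_pos.2 hlt12, by rw [hεdef]; linarith⟩
      -- on `u`-times `< T` the slices of the patch EQUAL those of the classical `u`
      have hrepD : ∀ t' ∈ Ioo 0 (τ₂ - τ₁),
          fderiv ℝ ((fun t => w (t + ε)) t') = fderiv ℝ (u (t' + τ₁)) := by
        intro t' ht'
        have ht'T : t' + τ₁ < T := by linarith [ht'.2]
        have ht'0 : 0 ≤ t' + τ₁ := by linarith [ht'.1, hτ₁.1]
        have hcu : Continuous (u (t' + τ₁)) := (hcl.contDiff_velocity ⟨ht'0, ht'T⟩).continuous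
        have hcw : Continuous (w (t' + ε)) :=
          (hw'.contDiff_velocity ⟨ht'.1.le, ht'.2.le.trans hs12.2⟩).continuous
        have heq : u (t' + τ₁) = w (t' + ε) :=
          (Continuous.ae_eq_iff_eq volume hcu hcw).1 (hrep' t' ⟨ht'.1.le, ht'.2.le.trans hs12.2⟩)
        simp only [heq]
      -- the gradient time integral of the representative
      have hint := lintegral_gradient_rep (u := u) (r := r) (q' := q') hrepD
      have e2 : τ₁ + (τ₂ - τ₁) = τ₂ := by ring
      rw [e2] at hint
      have hsub12 : Ioo τ₁ τ₂ ⊆ Ioo 0 T := Ioo_subset_Ioo (by linarith [hτ₁.1]) hτ₂T.le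
      have hfin12 : ∫⁻ σ' in Ioo τ₁ τ₂, a σ' ≠ ⊤ := ne_top_of_le_ne_top hA (lintegral_mono_set hsub12)
      have hfinw : ∫⁻ t' in Ioo 0 (τ₂ - τ₁), ENNReal.ofReal
          ((eLpNorm (fderiv ℝ ((fun t => w (t + ε)) t')) r volume).toReal ^
            (1 / (1 - 3 / (2 * r.toReal)))) ≠ ⊤ := by
        rw [← hq', hint]; exact hfin12
      -- a.e. slice of the representative in `L^r`
      have hLrw : ∀ᵐ t' ∂volume, t' ∈ Ioo 0 (τ₂ - τ₁) →
          eLpNorm (fderiv ℝ ((fun t => w (t + ε)) t')) r volume < ⊤ := by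
        filter_upwards [ae_comp_add_right hLr τ₁] with t' ht' ht'I
        rw [hrepD t' ht'I]
        exact ht' (hsub12 ⟨by linarith [ht'I.1], by linarith [ht'I.2]⟩)
      -- Beirão da Veiga's enstrophy inequality on the translated slab
      have hineq := hD2 hν hL hw' hbw' hbwt' hbπ' hs12 hLrw hfinw
      rw [← hq', hint] at hineq
      -- identify the enstrophies with those of `u`
      have hy2 : eWeakGradL2Sq (u τ₂) =
          ∫⁻ x, ENNReal.ofReal (frobeniusNormSq (fderiv ℝ (w (τ₂ - τ₁ + ε)) x)) := by
        have h := eWeakGradL2Sq_rep hw' ⟨hs12.1.le, hs12.2⟩ (hrep' (τ₂ - τ₁) ⟨hs12.1.le, hs12.2⟩)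
        rwa [sub_add_cancel] at h
      have hy1 : eWeakGradL2Sq (u τ₁) =
          ∫⁻ x, ENNReal.ofReal (frobeniusNormSq (fderiv ℝ (w (0 + ε)) x)) := by
        have h := eWeakGradL2Sq_rep hw' ⟨le_rfl, hL.le⟩ (hrep' 0 ⟨le_rfl, hL.le⟩)
        rwa [zero_add τ₁] at h
      have hstep : eWeakGradL2Sq (u τ₂) ≤
          ENNReal.ofReal (Real.exp (Cν * (∫⁻ σ' in Ioo τ₁ τ₂, a σ').toReal)) * eWeakGradL2Sq (u τ₁) := by
        rw [hy2, hy1]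
        exact hineq
      have hfin02 : ∫⁻ σ' in Ioo t₀ τ₂, a σ' ≠ ⊤ :=
        ne_top_of_le_ne_top hA (lintegral_mono_set (Ioo_subset_Ioo ht₀0.le hτ₂T.le))
      exact exp_lintegral_chain (y := fun τ => eWeakGradL2Sq (u τ)) (a := a) (C := Cν) (y₀ := y₀)
        hτ₁.1 hτ₁₂ hfin02 hP1 hstep
  -- conclusion
  refine hPt.trans (mul_le_mul_left (ENNReal.ofReal_le_ofReal (Real.exp_le_exp.2
    (mul_le_mul_of_nonneg_left ?_ hCν0))) _)
  exact ENNReal.toReal_mono hA (lintegral_mono_set (Ioo_subset_Ioo ht₀0.le htT.le))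

/-- **The continuation hypothesis in the Beirão da Veiga class**: for a classical solution on
`ℝ³ × [0, T)`, Leray–Hopf on `[0, T)`, with `∇u ∈ L^q(0,T; L^r)` (`2/q + 3/r = 2`) in the form of
a finite time integral and a.e. `L^r` slices, `limsup_{t → β⁻} ‖u(t)‖²_{H¹} < ∞` at the right end
`β` of every `H¹`-regular interval `(α, β) ⊆ (0, T)` — the hypothesis of Leray's continuation
theorem `leray_continuation_H1` (energy from the datum, `IsLerayHopfOn.eEnergy_le_datum`;
enstrophy from `exists_eWeakGradL2Sq_le_of_gradient`). [cite: BerselliGaldi2002, (1.3) p. 3586]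
[cite: RobinsonRodrigoSadowski2016, Lemma 8.16 (proof)] -/
theorem limsup_eH1NormSq_lt_top_of_gradient {c : ℝ} (hL2 : TaoH1AlmostRegularWith c) (hc : 0 < c)
    (hν : 0 < ν) (hLH : IsLerayHopfOn T ν 0 u₀ u) (hcl : IsClassicalNSSolutionOn (Ico 0 T) ν 0 u p)
    {r : ℝ≥0∞} (hr : 3 / 2 < r) (hrtop : r ≠ ⊤)
    (hLr : ∀ᵐ σ ∂volume, σ ∈ Ioo 0 T → eLpNorm (fderiv ℝ (u σ)) r volume < ⊤)
    (hA : ∫⁻ t in Ioo 0 T, ENNReal.ofReal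
      ((eLpNorm (fderiv ℝ (u t)) r volume).toReal ^ (1 / (1 - 3 / (2 * r.toReal)))) ≠ ⊤)
    {α β : ℝ} (hα : 0 ≤ α) (hαβ : α < β) (hβ : β ≤ T) (hreg : IsH1RegularOn (Ioo α β) u) :
    limsup (fun t => eH1NormSq (u t)) (𝓝[<] β) < ⊤ := by
  set t₀ : ℝ := (α + β) / 2 with ht₀
  have ht₀m : t₀ ∈ Ioo α β := ⟨by rw [ht₀]; linarith, by rw [ht₀]; linarith⟩
  obtain ⟨K, hK, hbound⟩ :=
    exists_eWeakGradL2Sq_le_of_gradient hL2 hc hν hLH hcl hr hrtop hLr hA hα hβ hreg ht₀m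
  set E₀ : ℝ≥0∞ := ENNReal.ofReal (2 * VectorCalculus.kineticEnergy u₀) with hE₀
  have hev : ∀ᶠ t in 𝓝[<] β, eH1NormSq (u t) ≤ E₀ + K := by
    filter_upwards [Ioo_mem_nhdsLT ht₀m.2] with t ht
    have htT : t ∈ Icc 0 T := ⟨(hα.trans ht₀m.1.le).trans ht.1.le, ht.2.le.trans hβ⟩
    exact add_le_add (hLH.eEnergy_le_datum hν.le htT) (hbound t ⟨ht.1.le, ht.2⟩)
  refine lt_of_le_of_lt (Filter.limsup_le_of_le (by isBoundedDefault) hev) ?_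
  exact ENNReal.add_lt_top.2 ⟨ENNReal.ofReal_lt_top, hK⟩

end StepA

/-! ### The discharge -/

section Discharge

/-- **Beirão da Veiga's gradient criterion (continuation form on `ℝ³`), discharged**: the named
fact `BeiraoDaVeiga1995_gradientCriterion` (`GradientRegularityCriteria.lean`; Beirão da Veiga
1995; Berselli–Galdi 2002, (1.3) p. 3586: "if `∇u ∈ L^r(0,T;L^s(ℝⁿ))` with `2/r + n/s = 2`, for
`s > n/2`, then weak solutions are of class `C^∞(ℝⁿ × (0,T])`"; Lemarié-Rieusset 2016, §11.5
p. 329). Proof: the exponents give `3/2 < r < ∞` and `q = 2r/(2r-3)` (`bdv_exponents`), the mixed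
class gives a finite time integral `∫₀ᵀ ‖∇u‖_{L^r}^q` and a.e. `L^r` slices
(`lintegral_ofReal_rpow_gradient_lt_top`); hence the `H¹` norm cannot blow up at the right end of
an interval of regularity (`limsup_eH1NormSq_lt_top_of_gradient`, Beirão da Veiga's enstrophy
inequality on Tao patches), so `u` is `H¹`-regular on `(0, T]` by Leray's continuation theorem
(`leray_continuation_H1_holds`); finally, exactly as in the tree's continuation of bounded
solutions (`hasSmoothExtensionPast_of_bounded_of_local_H1_theory`; Robinson–Rodrigo–Sadowski 2016,
proof of Thm. 12.3, p. 170), restart at a good time `s` near `T` with Leray's local strong solution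
(`leray_local_strong_H1_holds`, lifespan beyond `T` by the `H¹` bound on `[T/2, T]`), represent it
classically (`ladyzhenskaya_prodi_serrin_holds`, class `L^∞_t L⁶_x`), identify it with `u` on
`(s, T)` by weak–strong uniqueness and continuity, and glue (`IsClassicalNSSolutionOn.glue`). The
rapid-decay hypothesis of the fact is not needed. [cite: BerselliGaldi2002, (1.3) p. 3586]
[cite: LemarieRieusset2016, §11.5 p. 329 (PDF p. 353)]
[cite: RobinsonRodrigoSadowski2016, Thm. 8.17 with Lemma 8.16 and proof of Thm. 12.3] -/
theorem BeiraoDaVeiga1995_gradientCriterion_holds : BeiraoDaVeiga1995_gradientCriterion := by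
  intro ν T hν hT u p hcl hLH _ q r h1q hqtop hqr hS
  obtain ⟨c, hc, hL2⟩ := tao2011_H1_local_almost_regular_holds
  obtain ⟨hrtop, hr, -⟩ := bdv_exponents h1q hqtop hqr
  obtain ⟨hA, hLr⟩ := lintegral_ofReal_rpow_gradient_lt_top h1q hqtop hqr hS
  -- `u` is `H¹`-regular on `(0, T]`
  have hregT : IsH1RegularOn (Ioc 0 T) u :=
    leray_continuation_H1_holds ν T hν hT (u 0) u hLH fun α β hα hαβ hβ hregI =>
      limsup_eH1NormSq_lt_top_of_gradient hL2 hc hν hLH hcl hr hrtop hLr hA.ne hα hαβ hβ hregI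
  -- `‖u(t)‖²_{H¹} ≤ A < ∞` on `[T/2, T]`
  have hreg : IsH1RegularOn (Icc (T / 2) T) u :=
    hregT.mono fun t ht => ⟨by linarith [ht.1], ht.2⟩
  obtain ⟨A, hAtop, hAle⟩ := hreg.exists_forall_le isCompact_Icc subset_rfl
  -- Leray's lifespan for data of squared `H¹` norm `≤ a = A.toReal`
  obtain ⟨c', hc', hlocc⟩ := leray_local_strong_H1_holds
  have hLPS : ladyzhenskaya_prodi_serrin := ladyzhenskaya_prodi_serrin_holds
  set a : ℝ := A.toReal with ha
  have ha0 : 0 ≤ a := ENNReal.toReal_nonneg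
  set τ : ℝ := c' * ν ^ 3 / (a ^ 2 + 1) with hτ
  have hcν : 0 < c' * ν ^ 3 := mul_pos hc' (pow_pos hν 3)
  have hτpos : 0 < τ := div_pos hcν (by positivity)
  have hτc : a ^ 2 * τ ≤ c' * ν ^ 3 := by
    have h1 : a ^ 2 * τ = c' * ν ^ 3 * (a ^ 2 / (a ^ 2 + 1)) := by
      rw [hτ]
      ring
    rw [h1]
    exact mul_le_of_le_one_right hcν.le (div_le_one_of_le₀ (by linarith) (by positivity))
  -- a good restart time `s ∈ (max (T/2) (T - τ/2), T)`
  set s₀ : ℝ := max (T / 2) (T - τ / 2) with hs₀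
  have hs₀0 : 0 ≤ s₀ := le_max_of_le_left (by linarith)
  have hs₀T : s₀ < T := max_lt (by linarith) (by linarith)
  obtain ⟨s, hs, hLHs⟩ := hLH.exists_isLerayHopfOn_restart_Ioo hν.le hs₀0 hs₀T le_rfl
  have hsT2 : T / 2 ≤ s := (le_max_left _ _).trans hs.1.le
  have hsτ : T < s + τ := by
    have h1 : T - τ / 2 < s := (le_max_right _ _).trans_lt hs.1
    linarith
  have hs0 : 0 < s := by linarith
  have hTs : 0 < T - s := sub_pos.2 hs.2
  have hTsτ : T - s ≤ τ := by linarith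
  -- the datum `u s ∈ H¹` with `‖∇u(s)‖² ≤ a`
  have hu2 : MemLp (u s) 2 volume := hLH.memLp s ⟨hs0.le, hs.2.le⟩
  have hdiv : IsWeaklyDivFree (u s) := hLHs.isWeaklyDivFree_datum hTs
  have hgrad : eWeakGradL2Sq (u s) ≤ ENNReal.ofReal a := by
    calc eWeakGradL2Sq (u s) ≤ eH1NormSq (u s) := le_add_self
      _ ≤ A := hAle s ⟨hsT2, hs.2.le⟩
      _ = ENNReal.ofReal a := (ENNReal.ofReal_toReal hAtop.ne).symm
  -- Leray's local strong solution `v` from `u s` on `[0, τ]` (RRS Thm. 6.15)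
  obtain ⟨v, hv, hv0, hvreg⟩ := hlocc hν hτpos hu2 hdiv ha0 hgrad hτc
  -- its classical representative `(V, P)` on `(0, τ]` (RRS Thm. 8.17, first clause, `L^∞_t L⁶_x`)
  have hvS : MemLqLp ∞ 6 v (Ioo 0 τ) :=
    memLqLp_top_six_of_isH1RegularOn_Icc hvreg fun t ht => hv.memLp t ht
  have hr6 : (3 : ℝ≥0∞) < 6 := by norm_num
  have hqr6 : 2 / (∞ : ℝ≥0∞) + 3 / (6 : ℝ≥0∞) ≤ 1 := by
    rw [ENNReal.div_top, zero_add]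
    exact ENNReal.div_le_of_le_mul (by norm_num)
  obtain ⟨V, P, hVP, hvV⟩ := hLPS hν hτpos hv hr6 hqr6 hvS
  -- weak–strong uniqueness on `[0, T - s)`: `u (t + s) = v t` a.e., `0 < t ≤ T - s`
  have hae : ∀ t ∈ Ioc 0 (T - s), (fun t => u (t + s)) t =ᵐ[volume] v t :=
    serrin_weak_strong_uniqueness_holds hν hTs (hv.of_le hTsτ) hu2 (q := ∞) (r := 6) hr6
      hqr6 (hvS.mono_set (Ioo_subset_Ioo_right hTsτ)) hLHs
  -- everywhere agreement of the continuous slices on `(s, T)`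
  have heq : ∀ t ∈ Ioo s T, u t = V (t + -s) := by
    intro t ht
    have hts : t - s ∈ Ioc 0 (T - s) := ⟨sub_pos.2 ht.1, by linarith [ht.2]⟩
    have h1 : u t =ᵐ[volume] v (t - s) := by
      have h := hae (t - s) hts
      simpa only [sub_add_cancel] using h
    have h2 : v (t - s) =ᵐ[volume] V (t - s) := hvV (t - s) ⟨hts.1, hts.2.trans hTsτ⟩
    have hcu : Continuous (u t) :=
      (hcl.contDiff_velocity ⟨hs0.le.trans ht.1.le, ht.2⟩).continuous
    have hcV : Continuous (V (t - s)) :=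
      (hVP.contDiff_velocity ⟨hts.1, hts.2.trans hTsτ⟩).continuous
    rw [← sub_eq_add_neg]
    exact (Continuous.ae_eq_iff_eq volume hcu hcV).1 (h1.trans h2)
  -- the continuation piece `(V, P)(· - s)` on `(s, s + τ)`
  have h₂ : IsClassicalNSSolutionOn (Ioo s (s + τ)) ν 0 (fun t => V (t + -s))
      (fun t => P (t + -s)) := by
    have hVP' := hVP.comp_add_right (-s)
    have h0 : (fun t => (0 : ℝ → EuclideanSpace ℝ (Fin 3) → EuclideanSpace ℝ (Fin 3)) (t + -s)) = 0 :=
      rfl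
    rw [h0] at hVP'
    exact hVP'.mono (fun t ht => ⟨by simp only [mem_Ioo] at ht ⊢; linarith [ht.1],
      by simp only [mem_Ioo] at ht ⊢; linarith [ht.2]⟩) isOpen_Ioo.uniqueDiffOn
  -- glue along the overlap `(s, T)`
  exact ⟨s + τ, hsτ, _, _, hcl.glue h₂ hs0.le hs.2 hsτ.le heq, fun t ht => by
    simp only [if_pos ht.2]⟩

end Discharge

end Literature.Analysis.FluidPDE

end
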